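import Literature.NumberTheory.Automorphic.UnitaryGroupHyperbolicBorelRefinedFibre
import Literature.NumberTheory.Automorphic.UnitaryGroupHyperbolicJKernelUnfolding
import HarnessLib

/-!
# The truncated trace of the regular hyperbolic class: `J^T_{i♯}(f) = ∫_X j_T dμ − ∫_X R_T dμ`
(Rogawski, *Automorphic Representations of Unitary Groups in Three Variables* (1990), §2.2 p. 13, §6.1 pp. 79–81
((6.1.1)–(6.1.3)); Arthur, *A trace formula for reductive groups I*, Duke Math. J. 45 (1978), §8.)

For the refined regular hyperbolic class `i♯ = (p♯ ⊗ 𝔸_E, true)`, `p♯ = (X − a)(X − b)(X − (c a)⁻¹)`, `c a · a ≠ 1`,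
`c b · b = 1`, of the Borel-refined characteristic-polynomial class map `cl♭` (★ `UnitaryGroupHyperbolicBorelRefinedFibre`),
Arthur's `j`-kernel ★ `truncatedKernelClass_borelRefine_hyperbolic_eq_tsum_mul_weight_sub_sum` reads, pointwise on `G(𝔸_F)`,

  `k^T_{i♯}(x) = j_T(x) − R_T(x)`,
  `j_T(x) = Σ'_{γ′ ∈ cl♭⁻¹{i♯}} f(x⁻¹γ′x)·(1 − [T < H(sec γ′·x)] − [T < H(w♯·sec γ′·x)])`,
  `R_T(x) = Σ_{q ∈ S_T(x)} D(q̃x) = Ψ[1_{T<H}·D](x)`, `D(y) = K_{B,i♯}(y,y) − K^Σ_{B,i♯}(y,y)`,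

`Ψ` the pseudo-Eisenstein (lattice) sum over `B(F)∖G(F)` (★ `pseudoEisenstein`). This file is the first, purely formal,
step of the assembly of the hyperbolic term of the coarse geometric expansion: §1 the finite sum `Σ_{q ∈ S_T(x)}` IS the
pseudo-Eisenstein series of the cut-off `1_{T<H}·D` (so the cusp-remainder files, which speak `Ψ`, apply verbatim);
§2 `k^T_{i♯} = j_T − Ψ[1_{T<H}·D]` as FUNCTIONS; §3 `J^T_{i♯}(f) = truncatedTraceClass = ∫_X quotFun j_T dμ − ∫_X quotFun Ψ[1_{T<H}·D] dμ`
as soon as both descended functions are `μ`-integrable (Bochner linearity; `quotFun` is additive definitionally);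
§4 THE UNFOLDED FORM `J^T_{i♯}(f) = c_μ · ∫_{G(𝔸)} β(g)·f(g⁻¹γ♯g)·u_T(g) dν_G(g) − ∫_X quotFun Ψ[1_{T<H}·D] dμ` (★
`integrable_quotFun_jKernel_and_integral_eq_mul_integral` of ★ `UnitaryGroupHyperbolicJKernelUnfolding` at `cl♭`, whose
class-of-`γ♯` hypothesis `hi` is ★ `borelRefine_charpoly_mk_toAdelic_of_eq_hyperbolicDiagonal`), under the finiteness
`hfin` of the unfolded majorant (the torus-fibre step) and the integrability of the descended cusp remainder.

Theorems only; no definitions, no instances, no notation.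
-/

open MeasureTheory Measure NumberField IsDedekindDomain Set Matrix Polynomial
open Literature.MeasureTheory.Group
open scoped NNReal ENNReal Classical MatrixGroups

namespace Literature.NumberTheory.Automorphic

namespace UnitaryGroup

variable {F E : Type} [Field F] [NumberField F] [Field E] [NumberField E] [Algebra F E]
  {c : E ≃ₐ[F] E}

/-! ## §1 The finite cut-off sum is the pseudo-Eisenstein series of `1_{T<H}·D` -/

section FiniteSum

/-- **`Σ_{q ∈ S_T(x)} D(q̃x) = Ψ[1_{T<H}·D](x)`**: the finite sum over the cut-off rational Borels
`S_T(x) = {q ∈ B(F)∖G(F) : T < H(q̃x)}` (★ `finite_setOf_lt_borelHeight`, `T > 0`) of any `D : G(𝔸_F) → ℂ` is the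
pseudo-Eisenstein series of `1_{T<H}·D`. [cite: Rogawski1990, §2.2 (p. 13)] [cite: Arthur1978TraceFormulaI, §8] -/
theorem sum_toFinset_eq_pseudoEisenstein_indicator {T : ℝ≥0} (hT : 0 < T) (D : (quasiSplit F E c 3).Adelic → ℂ)
    (x : (quasiSplit F E c 3).Adelic) :
    ∑ q ∈ (finite_setOf_lt_borelHeight x hT).toFinset,
        D (((q.out : (quasiSplit F E c 3).arithmeticSubgroup) : (quasiSplit F E c 3).Adelic) * x) =
      pseudoEisenstein ({y : (quasiSplit F E c 3).Adelic | T < borelHeight y}.indicator D) x := by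
  have hsub : (Function.support fun q : Quotient (QuotientGroup.rightRel (arithmeticBorel F E c 3)) =>
      ({y : (quasiSplit F E c 3).Adelic | T < borelHeight y}.indicator D)
        (((q.out : (quasiSplit F E c 3).arithmeticSubgroup) : (quasiSplit F E c 3).Adelic) * x)) ⊆
      ↑(finite_setOf_lt_borelHeight x hT).toFinset := by
    rw [Set.Finite.coe_toFinset]
    intro q hq
    by_contra hlt
    exact hq (Set.indicator_of_notMem (s := {y : (quasiSplit F E c 3).Adelic | T < borelHeight y}) hlt D)
  rw [pseudoEisenstein_def, finsum_eq_sum_of_support_subset _ hsub]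
  refine Finset.sum_congr rfl fun q hq => ?_
  rw [Set.Finite.mem_toFinset] at hq
  exact (Set.indicator_of_mem (s := {y : (quasiSplit F E c 3).Adelic | T < borelHeight y}) hq D).symm

end FiniteSum

/-! ## §2 `k^T_{i♯} = j_T − Ψ[1_{T<H}·D]` as functions -/

section Pointwise

variable [MeasurableSpace (adelicUnipotent F E c 3)]

/-- **`k^T_{i♯} = j_T − Ψ[1_{T<H}·D]` AS FUNCTIONS ON `G(𝔸_F)`** for the refined regular hyperbolic class (any
section `sec` of the fibre, ★ `exists_section_borelRefine_hyperbolic`; `T > 0`; `f` of compact support): ★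
`truncatedKernelClass_borelRefine_hyperbolic_eq_tsum_mul_weight_sub_sum` + §1.
[cite: Rogawski1990, §6.1 (pp. 79–81)] [cite: Arthur1978TraceFormulaI, §8] -/
theorem truncatedKernelClass_borelRefine_hyperbolic_eq_jKernel_sub_pseudoEisenstein
    (ν : Measure (adelicUnipotent F E c 3))
    (𝓕 : Set (adelicUnipotent F E c 3)) (hc : c * c = 1) {a b : Eˣ} (ha : c (a : E) * (a : E) ≠ 1)
    (hb : c (b : E) * (b : E) = 1) {g₀ w : (quasiSplit F E c 3).Rational}
    (hg₀ : ((g₀.1 : GL (Fin 3) E) : Matrix (Fin 3) (Fin 3) E) = !![(a : E), 0, 0; 0, b, 0; 0, 0, (c (a : E))⁻¹])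
    (hw : ((w.1 : GL (Fin 3) E) : Matrix (Fin 3) (Fin 3) E) = !![(0 : E), 0, 1; 0, 1, 0; 1, 0, 0])
    {T : ℝ≥0} (hT : 0 < T)
    (sec : ((fun γ : (quasiSplit F E c 3).arithmeticSubgroup =>
        (((adelicVal F E c 3 _ (γ : (quasiSplit F E c 3).Adelic) : GL (Fin 3) (AdeleRing (𝓞 E) E)) :
            Matrix (Fin 3) (Fin 3) (AdeleRing (𝓞 E) E)).charpoly,
          decide (∃ δ : (quasiSplit F E c 3).arithmeticSubgroup, δ * γ * δ⁻¹ ∈ arithmeticBorel F E c 3))) ⁻¹'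
        {(((X - C (a : E)) * (X - C (b : E)) * (X - C (c (a : E))⁻¹)).map (algebraMap E (AdeleRing (𝓞 E) E)), true)}) →
        (quasiSplit F E c 3).arithmeticSubgroup)
    (hsec : ∀ γ, (sec γ)⁻¹ * ⟨(quasiSplit F E c 3).toAdelic g₀, g₀, rfl⟩ * sec γ =
        (γ : (quasiSplit F E c 3).arithmeticSubgroup))
    {f : (quasiSplit F E c 3).Adelic → ℂ} (hf : HasCompactSupport f) :
    truncatedKernelClass ν 𝓕 T
        (fun γ : (quasiSplit F E c 3).arithmeticSubgroup =>
          (((adelicVal F E c 3 _ (γ : (quasiSplit F E c 3).Adelic) : GL (Fin 3) (AdeleRing (𝓞 E) E)) :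
              Matrix (Fin 3) (Fin 3) (AdeleRing (𝓞 E) E)).charpoly,
            decide (∃ δ : (quasiSplit F E c 3).arithmeticSubgroup, δ * γ * δ⁻¹ ∈ arithmeticBorel F E c 3)))
        (((X - C (a : E)) * (X - C (b : E)) * (X - C (c (a : E))⁻¹)).map (algebraMap E (AdeleRing (𝓞 E) E)), true) f =
      (fun x => ∑' γ : ((fun γ : (quasiSplit F E c 3).arithmeticSubgroup =>
          (((adelicVal F E c 3 _ (γ : (quasiSplit F E c 3).Adelic) : GL (Fin 3) (AdeleRing (𝓞 E) E)) :
              Matrix (Fin 3) (Fin 3) (AdeleRing (𝓞 E) E)).charpoly,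
            decide (∃ δ : (quasiSplit F E c 3).arithmeticSubgroup, δ * γ * δ⁻¹ ∈ arithmeticBorel F E c 3))) ⁻¹'
          {(((X - C (a : E)) * (X - C (b : E)) * (X - C (c (a : E))⁻¹)).map (algebraMap E (AdeleRing (𝓞 E) E)), true)}),
        f (x⁻¹ * ((γ : (quasiSplit F E c 3).arithmeticSubgroup) : (quasiSplit F E c 3).Adelic) * x) *
          (1 - (if T < borelHeight (((sec γ : (quasiSplit F E c 3).arithmeticSubgroup) : (quasiSplit F E c 3).Adelic) * x)
                  then (1 : ℂ) else 0) -
               (if T < borelHeight ((((⟨(quasiSplit F E c 3).toAdelic w, w, rfl⟩ * sec γ :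
                  (quasiSplit F E c 3).arithmeticSubgroup)) : (quasiSplit F E c 3).Adelic) * x) then (1 : ℂ) else 0))) -
      pseudoEisenstein ({y : (quasiSplit F E c 3).Adelic | T < borelHeight y}.indicator fun y =>
        kernelBorelClass ν 𝓕
            (fun γ : (quasiSplit F E c 3).arithmeticSubgroup =>
              (((adelicVal F E c 3 _ (γ : (quasiSplit F E c 3).Adelic) : GL (Fin 3) (AdeleRing (𝓞 E) E)) :
                  Matrix (Fin 3) (Fin 3) (AdeleRing (𝓞 E) E)).charpoly,
                decide (∃ δ : (quasiSplit F E c 3).arithmeticSubgroup, δ * γ * δ⁻¹ ∈ arithmeticBorel F E c 3)))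
            (((X - C (a : E)) * (X - C (b : E)) * (X - C (c (a : E))⁻¹)).map (algebraMap E (AdeleRing (𝓞 E) E)), true) f y y -
          borelSumClass
            (fun γ : (quasiSplit F E c 3).arithmeticSubgroup =>
              (((adelicVal F E c 3 _ (γ : (quasiSplit F E c 3).Adelic) : GL (Fin 3) (AdeleRing (𝓞 E) E)) :
                  Matrix (Fin 3) (Fin 3) (AdeleRing (𝓞 E) E)).charpoly,
                decide (∃ δ : (quasiSplit F E c 3).arithmeticSubgroup, δ * γ * δ⁻¹ ∈ arithmeticBorel F E c 3)))
            (((X - C (a : E)) * (X - C (b : E)) * (X - C (c (a : E))⁻¹)).map (algebraMap E (AdeleRing (𝓞 E) E)), true) f y y) := by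
  funext x
  rw [Pi.sub_apply, truncatedKernelClass_borelRefine_hyperbolic_eq_tsum_mul_weight_sub_sum ν 𝓕 hc ha hb hg₀ hw hT sec hsec hf x,
    ← sum_toFinset_eq_pseudoEisenstein_indicator hT _ x]

end Pointwise

/-! ## §3 `J^T_{i♯}(f) = ∫_X quotFun j_T dμ − ∫_X quotFun Ψ[1_{T<H}·D] dμ` -/

section Integral

variable [MeasurableSpace (adelicUnipotent F E c 3)]

/-- **`J^T_{i♯}(f) = ∫_X j_T − ∫_X R_T`**: the truncated trace of the refined regular hyperbolic class is the integral
of the descended `j`-kernel minus the integral of the descended cusp remainder `R_T = Ψ[1_{T<H}·D]`, as soon as both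
descended functions are `μ`-integrable (★ `quotFun` is additive definitionally; Bochner `integral_sub`).
[cite: Rogawski1990, §6.1 (pp. 79–81)] [cite: Arthur1978TraceFormulaI, §8] -/
theorem truncatedTraceClass_borelRefine_hyperbolic_eq_integral_sub_integral
    (μ : Measure (quasiSplit F E c 3).automorphicQuotient) (ν : Measure (adelicUnipotent F E c 3))
    (𝓕 : Set (adelicUnipotent F E c 3)) (hc : c * c = 1) {a b : Eˣ} (ha : c (a : E) * (a : E) ≠ 1)
    (hb : c (b : E) * (b : E) = 1) {g₀ w : (quasiSplit F E c 3).Rational}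
    (hg₀ : ((g₀.1 : GL (Fin 3) E) : Matrix (Fin 3) (Fin 3) E) = !![(a : E), 0, 0; 0, b, 0; 0, 0, (c (a : E))⁻¹])
    (hw : ((w.1 : GL (Fin 3) E) : Matrix (Fin 3) (Fin 3) E) = !![(0 : E), 0, 1; 0, 1, 0; 1, 0, 0])
    {T : ℝ≥0} (hT : 0 < T)
    (sec : ((fun γ : (quasiSplit F E c 3).arithmeticSubgroup =>
        (((adelicVal F E c 3 _ (γ : (quasiSplit F E c 3).Adelic) : GL (Fin 3) (AdeleRing (𝓞 E) E)) :
            Matrix (Fin 3) (Fin 3) (AdeleRing (𝓞 E) E)).charpoly,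
          decide (∃ δ : (quasiSplit F E c 3).arithmeticSubgroup, δ * γ * δ⁻¹ ∈ arithmeticBorel F E c 3))) ⁻¹'
        {(((X - C (a : E)) * (X - C (b : E)) * (X - C (c (a : E))⁻¹)).map (algebraMap E (AdeleRing (𝓞 E) E)), true)}) →
        (quasiSplit F E c 3).arithmeticSubgroup)
    (hsec : ∀ γ, (sec γ)⁻¹ * ⟨(quasiSplit F E c 3).toAdelic g₀, g₀, rfl⟩ * sec γ =
        (γ : (quasiSplit F E c 3).arithmeticSubgroup))
    {f : (quasiSplit F E c 3).Adelic → ℂ} (hf : HasCompactSupport f)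
    (hJ : Integrable ((quasiSplit F E c 3).quotFun (fun x => ∑' γ : ((fun γ : (quasiSplit F E c 3).arithmeticSubgroup =>
          (((adelicVal F E c 3 _ (γ : (quasiSplit F E c 3).Adelic) : GL (Fin 3) (AdeleRing (𝓞 E) E)) :
              Matrix (Fin 3) (Fin 3) (AdeleRing (𝓞 E) E)).charpoly,
            decide (∃ δ : (quasiSplit F E c 3).arithmeticSubgroup, δ * γ * δ⁻¹ ∈ arithmeticBorel F E c 3))) ⁻¹'
          {(((X - C (a : E)) * (X - C (b : E)) * (X - C (c (a : E))⁻¹)).map (algebraMap E (AdeleRing (𝓞 E) E)), true)}),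
        f (x⁻¹ * ((γ : (quasiSplit F E c 3).arithmeticSubgroup) : (quasiSplit F E c 3).Adelic) * x) *
          (1 - (if T < borelHeight (((sec γ : (quasiSplit F E c 3).arithmeticSubgroup) : (quasiSplit F E c 3).Adelic) * x)
                  then (1 : ℂ) else 0) -
               (if T < borelHeight ((((⟨(quasiSplit F E c 3).toAdelic w, w, rfl⟩ * sec γ :
                  (quasiSplit F E c 3).arithmeticSubgroup)) : (quasiSplit F E c 3).Adelic) * x) then (1 : ℂ) else 0)))) μ)
    (hR : Integrable ((quasiSplit F E c 3).quotFun (pseudoEisenstein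
      ({y : (quasiSplit F E c 3).Adelic | T < borelHeight y}.indicator fun y =>
        kernelBorelClass ν 𝓕
            (fun γ : (quasiSplit F E c 3).arithmeticSubgroup =>
              (((adelicVal F E c 3 _ (γ : (quasiSplit F E c 3).Adelic) : GL (Fin 3) (AdeleRing (𝓞 E) E)) :
                  Matrix (Fin 3) (Fin 3) (AdeleRing (𝓞 E) E)).charpoly,
                decide (∃ δ : (quasiSplit F E c 3).arithmeticSubgroup, δ * γ * δ⁻¹ ∈ arithmeticBorel F E c 3)))
            (((X - C (a : E)) * (X - C (b : E)) * (X - C (c (a : E))⁻¹)).map (algebraMap E (AdeleRing (𝓞 E) E)), true) f y y -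
          borelSumClass
            (fun γ : (quasiSplit F E c 3).arithmeticSubgroup =>
              (((adelicVal F E c 3 _ (γ : (quasiSplit F E c 3).Adelic) : GL (Fin 3) (AdeleRing (𝓞 E) E)) :
                  Matrix (Fin 3) (Fin 3) (AdeleRing (𝓞 E) E)).charpoly,
                decide (∃ δ : (quasiSplit F E c 3).arithmeticSubgroup, δ * γ * δ⁻¹ ∈ arithmeticBorel F E c 3)))
            (((X - C (a : E)) * (X - C (b : E)) * (X - C (c (a : E))⁻¹)).map (algebraMap E (AdeleRing (𝓞 E) E)), true) f y y))) μ) :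
    truncatedTraceClass μ ν 𝓕 T
        (fun γ : (quasiSplit F E c 3).arithmeticSubgroup =>
          (((adelicVal F E c 3 _ (γ : (quasiSplit F E c 3).Adelic) : GL (Fin 3) (AdeleRing (𝓞 E) E)) :
              Matrix (Fin 3) (Fin 3) (AdeleRing (𝓞 E) E)).charpoly,
            decide (∃ δ : (quasiSplit F E c 3).arithmeticSubgroup, δ * γ * δ⁻¹ ∈ arithmeticBorel F E c 3)))
        (((X - C (a : E)) * (X - C (b : E)) * (X - C (c (a : E))⁻¹)).map (algebraMap E (AdeleRing (𝓞 E) E)), true) f =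
      (∫ x, (quasiSplit F E c 3).quotFun (fun x => ∑' γ : ((fun γ : (quasiSplit F E c 3).arithmeticSubgroup =>
          (((adelicVal F E c 3 _ (γ : (quasiSplit F E c 3).Adelic) : GL (Fin 3) (AdeleRing (𝓞 E) E)) :
              Matrix (Fin 3) (Fin 3) (AdeleRing (𝓞 E) E)).charpoly,
            decide (∃ δ : (quasiSplit F E c 3).arithmeticSubgroup, δ * γ * δ⁻¹ ∈ arithmeticBorel F E c 3))) ⁻¹'
          {(((X - C (a : E)) * (X - C (b : E)) * (X - C (c (a : E))⁻¹)).map (algebraMap E (AdeleRing (𝓞 E) E)), true)}),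
        f (x⁻¹ * ((γ : (quasiSplit F E c 3).arithmeticSubgroup) : (quasiSplit F E c 3).Adelic) * x) *
          (1 - (if T < borelHeight (((sec γ : (quasiSplit F E c 3).arithmeticSubgroup) : (quasiSplit F E c 3).Adelic) * x)
                  then (1 : ℂ) else 0) -
               (if T < borelHeight ((((⟨(quasiSplit F E c 3).toAdelic w, w, rfl⟩ * sec γ :
                  (quasiSplit F E c 3).arithmeticSubgroup)) : (quasiSplit F E c 3).Adelic) * x) then (1 : ℂ) else 0))) x ∂μ) -
      ∫ x, (quasiSplit F E c 3).quotFun (pseudoEisenstein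
        ({y : (quasiSplit F E c 3).Adelic | T < borelHeight y}.indicator fun y =>
          kernelBorelClass ν 𝓕
              (fun γ : (quasiSplit F E c 3).arithmeticSubgroup =>
                (((adelicVal F E c 3 _ (γ : (quasiSplit F E c 3).Adelic) : GL (Fin 3) (AdeleRing (𝓞 E) E)) :
                    Matrix (Fin 3) (Fin 3) (AdeleRing (𝓞 E) E)).charpoly,
                  decide (∃ δ : (quasiSplit F E c 3).arithmeticSubgroup, δ * γ * δ⁻¹ ∈ arithmeticBorel F E c 3)))
              (((X - C (a : E)) * (X - C (b : E)) * (X - C (c (a : E))⁻¹)).map (algebraMap E (AdeleRing (𝓞 E) E)), true) f y y -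
            borelSumClass
              (fun γ : (quasiSplit F E c 3).arithmeticSubgroup =>
                (((adelicVal F E c 3 _ (γ : (quasiSplit F E c 3).Adelic) : GL (Fin 3) (AdeleRing (𝓞 E) E)) :
                    Matrix (Fin 3) (Fin 3) (AdeleRing (𝓞 E) E)).charpoly,
                  decide (∃ δ : (quasiSplit F E c 3).arithmeticSubgroup, δ * γ * δ⁻¹ ∈ arithmeticBorel F E c 3)))
              (((X - C (a : E)) * (X - C (b : E)) * (X - C (c (a : E))⁻¹)).map (algebraMap E (AdeleRing (𝓞 E) E)), true) f y y)) x ∂μ := by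
  rw [truncatedTraceClass_def,
    truncatedKernelClass_borelRefine_hyperbolic_eq_jKernel_sub_pseudoEisenstein ν 𝓕 hc ha hb hg₀ hw hT sec hsec hf,
    ← integral_sub hJ hR]
  rfl

end Integral

/-! ## §4 `J^T_{i♯}(f) = c_μ · ∫_{G(𝔸)} β·f(g⁻¹γ♯g)·u_T(g) dν_G − ∫_X quotFun Ψ[1_{T<H}·D] dμ` -/

section Unfold

variable [MeasurableSpace (adelicUnipotent F E c 3)]
  [MeasurableSpace (quasiSplit F E c 3).Adelic] [BorelSpace (quasiSplit F E c 3).Adelic]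

/-- **THE UNFOLDED TRUNCATED TRACE OF THE REGULAR HYPERBOLIC CLASS** (Rogawski (6.1.1), before the `A_M`-integration):
for an automorphic measure `μ` on `X`, an inversion-invariant Haar measure `ν_G` of `G(𝔸_F)`, a Borel `f` of compact
support, `T > 0`, a section `sec` of the fibre and a covering weight `β` of `G_γ(F) = Z_{G(F)}(γ♯)`, IF the unfolded
majorant is finite (`hfin`, the torus-fibre step) and the descended cusp remainder is `μ`-integrable (`hR`), then
`J^T_{i♯}(f) = c_μ · ∫_{G(𝔸)} (β g)·f(g⁻¹γ♯g)·(1 − [T<H g] − [T<H(w♯g)]) dν_G(g) − ∫_X quotFun Ψ[1_{T<H}·D] dμ`,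
`c_μ = unfoldingConstant G(F) count μ ν_G` (★ LAW 4's constant). §3 + ★ `integrable_quotFun_jKernel_and_integral_eq_mul_integral`
(its `hi` = ★ `borelRefine_charpoly_mk_toAdelic_of_eq_hyperbolicDiagonal`, its `hcl` = ★ `isConjInvariant_borelRefine`).
[cite: Rogawski1990, §6.1 (6.1.1)–(6.1.3)] [cite: Arthur1978TraceFormulaI, §8] -/
theorem truncatedTraceClass_borelRefine_hyperbolic_eq_mul_integral_sub_integral (hc : c * c = 1) {a b : Eˣ}
    (ha : c (a : E) * (a : E) ≠ 1) (hb : c (b : E) * (b : E) = 1) {g₀ w : (quasiSplit F E c 3).Rational}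
    (hg₀ : ((g₀.1 : GL (Fin 3) E) : Matrix (Fin 3) (Fin 3) E) = !![(a : E), 0, 0; 0, b, 0; 0, 0, (c (a : E))⁻¹])
    (hw : ((w.1 : GL (Fin 3) E) : Matrix (Fin 3) (Fin 3) E) = !![(0 : E), 0, 1; 0, 1, 0; 1, 0, 0])
    (μ : Measure (quasiSplit F E c 3).automorphicQuotient) [(quasiSplit F E c 3).IsAutomorphicMeasure μ]
    (νG : Measure (quasiSplit F E c 3).Adelic) [νG.IsHaarMeasure] [νG.IsInvInvariant]
    (ν : Measure (adelicUnipotent F E c 3)) (𝓕 : Set (adelicUnipotent F E c 3)) {T : ℝ≥0} (hT : 0 < T)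
    (sec : ((fun γ : (quasiSplit F E c 3).arithmeticSubgroup =>
        (((adelicVal F E c 3 _ (γ : (quasiSplit F E c 3).Adelic) : GL (Fin 3) (AdeleRing (𝓞 E) E)) :
            Matrix (Fin 3) (Fin 3) (AdeleRing (𝓞 E) E)).charpoly,
          decide (∃ δ : (quasiSplit F E c 3).arithmeticSubgroup, δ * γ * δ⁻¹ ∈ arithmeticBorel F E c 3))) ⁻¹'
        {(((X - C (a : E)) * (X - C (b : E)) * (X - C (c (a : E))⁻¹)).map (algebraMap E (AdeleRing (𝓞 E) E)), true)}) →
        (quasiSplit F E c 3).arithmeticSubgroup)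
    (hsec : ∀ γ, (sec γ)⁻¹ * ⟨(quasiSplit F E c 3).toAdelic g₀, g₀, rfl⟩ * sec γ =
        (γ : (quasiSplit F E c 3).arithmeticSubgroup))
    {f : (quasiSplit F E c 3).Adelic → ℂ} (hf : HasCompactSupport f) (hfm : Measurable f)
    {β : (quasiSplit F E c 3).Adelic → ℝ≥0∞}
    (hβ : IsCoveringWeight ((Subgroup.centralizer
      {(⟨(quasiSplit F E c 3).toAdelic g₀, g₀, rfl⟩ : (quasiSplit F E c 3).arithmeticSubgroup)}).map
        (quasiSplit F E c 3).arithmeticSubgroup.subtype) β)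
    (hfin : ∫⁻ g, β g * ‖f (g⁻¹ * (quasiSplit F E c 3).toAdelic g₀ * g) *
        ((1 : ℂ) - (if T < borelHeight g then (1 : ℂ) else 0) -
          (if T < borelHeight ((quasiSplit F E c 3).toAdelic w * g) then (1 : ℂ) else 0))‖ₑ ∂νG < ∞)
    (hR : Integrable ((quasiSplit F E c 3).quotFun (pseudoEisenstein
      ({y : (quasiSplit F E c 3).Adelic | T < borelHeight y}.indicator fun y =>
        kernelBorelClass ν 𝓕
            (fun γ : (quasiSplit F E c 3).arithmeticSubgroup =>
              (((adelicVal F E c 3 _ (γ : (quasiSplit F E c 3).Adelic) : GL (Fin 3) (AdeleRing (𝓞 E) E)) :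
                  Matrix (Fin 3) (Fin 3) (AdeleRing (𝓞 E) E)).charpoly,
                decide (∃ δ : (quasiSplit F E c 3).arithmeticSubgroup, δ * γ * δ⁻¹ ∈ arithmeticBorel F E c 3)))
            (((X - C (a : E)) * (X - C (b : E)) * (X - C (c (a : E))⁻¹)).map (algebraMap E (AdeleRing (𝓞 E) E)), true) f y y -
          borelSumClass
            (fun γ : (quasiSplit F E c 3).arithmeticSubgroup =>
              (((adelicVal F E c 3 _ (γ : (quasiSplit F E c 3).Adelic) : GL (Fin 3) (AdeleRing (𝓞 E) E)) :
                  Matrix (Fin 3) (Fin 3) (AdeleRing (𝓞 E) E)).charpoly,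
                decide (∃ δ : (quasiSplit F E c 3).arithmeticSubgroup, δ * γ * δ⁻¹ ∈ arithmeticBorel F E c 3)))
            (((X - C (a : E)) * (X - C (b : E)) * (X - C (c (a : E))⁻¹)).map (algebraMap E (AdeleRing (𝓞 E) E)), true) f y y))) μ) :
    haveI := t2Space_adeleRing_of_numberField E
    haveI := locallyCompactSpace_adeleRing' E
    haveI := secondCountableTopology_adeleRing E
    haveI : T2Space (quasiSplit F E c 3).Adelic :=
      inferInstanceAs (T2Space (adelic F E c 3 ((StdForm.antidiagonal 3).over E)))
    haveI : LocallyCompactSpace (quasiSplit F E c 3).Adelic :=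
      inferInstanceAs (LocallyCompactSpace (adelic F E c 3 ((StdForm.antidiagonal 3).over E)))
    haveI : SecondCountableTopology (quasiSplit F E c 3).Adelic :=
      inferInstanceAs (SecondCountableTopology (adelic F E c 3 ((StdForm.antidiagonal 3).over E)))
    haveI : DiscreteTopology (quasiSplit F E c 3).quotientSubgroup := by
      rw [quotientSubgroup_quasiSplit]; exact isDiscreteRational_quasiSplit
    letI := AdelicGroupData.measurableSpaceQuotientForm (quasiSplit F E c 3)
    haveI := AdelicGroupData.borelSpaceQuotientForm (quasiSplit F E c 3)
    haveI := AdelicGroupData.smulInvariantMeasureQuotientForm (quasiSplit F E c 3) μ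
    haveI := AdelicGroupData.isFiniteMeasureOnCompactsQuotientForm (quasiSplit F E c 3) μ
    truncatedTraceClass μ ν 𝓕 T
        (fun γ : (quasiSplit F E c 3).arithmeticSubgroup =>
          (((adelicVal F E c 3 _ (γ : (quasiSplit F E c 3).Adelic) : GL (Fin 3) (AdeleRing (𝓞 E) E)) :
              Matrix (Fin 3) (Fin 3) (AdeleRing (𝓞 E) E)).charpoly,
            decide (∃ δ : (quasiSplit F E c 3).arithmeticSubgroup, δ * γ * δ⁻¹ ∈ arithmeticBorel F E c 3)))
        (((X - C (a : E)) * (X - C (b : E)) * (X - C (c (a : E))⁻¹)).map (algebraMap E (AdeleRing (𝓞 E) E)), true) f =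
      ((unfoldingConstant (quasiSplit F E c 3).quotientSubgroup
            (count : Measure (quasiSplit F E c 3).quotientSubgroup) μ νG : ℝ) : ℂ) *
          ∫ g, (β g).toReal • (f (g⁻¹ * (quasiSplit F E c 3).toAdelic g₀ * g) *
            ((1 : ℂ) - (if T < borelHeight g then (1 : ℂ) else 0) -
              (if T < borelHeight ((quasiSplit F E c 3).toAdelic w * g) then (1 : ℂ) else 0))) ∂νG -
      ∫ x, (quasiSplit F E c 3).quotFun (pseudoEisenstein
        ({y : (quasiSplit F E c 3).Adelic | T < borelHeight y}.indicator fun y =>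
          kernelBorelClass ν 𝓕
              (fun γ : (quasiSplit F E c 3).arithmeticSubgroup =>
                (((adelicVal F E c 3 _ (γ : (quasiSplit F E c 3).Adelic) : GL (Fin 3) (AdeleRing (𝓞 E) E)) :
                    Matrix (Fin 3) (Fin 3) (AdeleRing (𝓞 E) E)).charpoly,
                  decide (∃ δ : (quasiSplit F E c 3).arithmeticSubgroup, δ * γ * δ⁻¹ ∈ arithmeticBorel F E c 3)))
              (((X - C (a : E)) * (X - C (b : E)) * (X - C (c (a : E))⁻¹)).map (algebraMap E (AdeleRing (𝓞 E) E)), true) f y y -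
            borelSumClass
              (fun γ : (quasiSplit F E c 3).arithmeticSubgroup =>
                (((adelicVal F E c 3 _ (γ : (quasiSplit F E c 3).Adelic) : GL (Fin 3) (AdeleRing (𝓞 E) E)) :
                    Matrix (Fin 3) (Fin 3) (AdeleRing (𝓞 E) E)).charpoly,
                  decide (∃ δ : (quasiSplit F E c 3).arithmeticSubgroup, δ * γ * δ⁻¹ ∈ arithmeticBorel F E c 3)))
              (((X - C (a : E)) * (X - C (b : E)) * (X - C (c (a : E))⁻¹)).map (algebraMap E (AdeleRing (𝓞 E) E)), true) f y y)) x ∂μ := by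
  obtain ⟨hJ, hval⟩ := integrable_quotFun_jKernel_and_integral_eq_mul_integral hc ha hb hg₀ hw μ νG
    (isConjInvariant_borelRefine isConjInvariant_charpoly_adelicVal)
    (borelRefine_charpoly_mk_toAdelic_of_eq_hyperbolicDiagonal hc ha hg₀) sec hsec hfm T hβ hfin
  rw [truncatedTraceClass_borelRefine_hyperbolic_eq_integral_sub_integral μ ν 𝓕 hc ha hb hg₀ hw hT sec hsec hf hJ hR, hval]

end Unfold

end UnitaryGroup

end Literature.NumberTheory.Automorphic
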